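import Literature.AlgebraicGeometry.Deformation.AdaptedLifts
import Literature.AlgebraicGeometry.Deformation.ObstructionCocycle
import Literature.AlgebraicGeometry.Modules.LocallyFreeTrace
import HarnessLib

/-!
# The trace of the obstruction cocycle is additive along a short exact sequence (cochain level)

Setting: `j : Y ⟶ Z₀`, `i : Z₀ ⟶ Z₁`, `eI : i_* j_* 𝒪_Y ≅ 𝓘` (`Deformation/IdealSectionsTransport.lean`),
a short exact sequence `0 → F₁ → F₂ → F₃ → 0` of `𝒪_{Z₀}`-modules with an ADAPTED frame cover
`A` (`Deformation/AdaptedLifts.lean`: frames of `F₁`, `F₃` over `i⁻¹U_a` and lifts of the basis of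
`F₃`, whence block upper triangular frames of `F₂`), systems of lifts `T̃¹`, `T̃³` of the transition
matrices of `F₁`, `F₃` and the adapted lifts `T̃² = [[T̃¹, X], [0, T̃³]]` of `F₂`. The obstruction
cocycles (`Deformation/ObstructionCocycle.lean`) of the three framed modules live on the SAME cover
`(j⁻¹i⁻¹U_a)_a` of `Y`, and we prove that **the traces of their local operators add up**:

  `tr(op(κ(c²)_{abd})) = tr(op(κ(c¹)_{abd})) + tr(op(κ(c³)_{abd}))`  (`trace_locOp_defectCochain_adapted`)

as functions on `Y` — because in the adapted base frames everything is block upper triangular: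
the reduced transition matrices (`T_baseFraming_adapted`), the defects read on `Y`
(`kdefAt_adapted`), hence the matrices `κ(c)·T̄` of the local operators, and the trace of a product of
block upper triangular matrices is the sum of the traces of the diagonal products
(`trace_fromBlocks_mul_fromBlocks`). Ingredients of independent use: the trace of a `matrixEnd`
is the trace of its matrix (`trace_app_matrixEnd`), `matrixOfIdeal` of a block matrix
(`matrixOfIdeal_fromBlocks`). This is the cochain-level content of the additivity of `σ₀ ∘ ob` on
short exact sequences (Buchweitz–Flenner 2003, Prop. 4.2 with 4.4; Mukai–Artamkin
`tr(ob F) = ob(det F)`), for the Čech obstruction cocycle of Hartshorne, *Deformation Theory*,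
Thm. 7.1. Everything is proved; no named facts.

## References

* R.-O. Buchweitz, H. Flenner, Compositio Math. 137 (2003), Prop. 4.2, Prop. 4.4. [BuchweitzFlenner2003]
* R. Hartshorne, *Deformation Theory*, GTM 257 (2010), §7, Thm. 7.1. [Hartshorne2010]
-/

noncomputable section

open CategoryTheory AlgebraicGeometry Opposite TopologicalSpace Limits

universe u

/-! ### The trace of a `matrixEnd` is the trace of its matrix -/

namespace Literature.AlgebraicGeometry.Modules

open Literature.AlgebraicGeometry.Motives

variable {X : Scheme.{u}} {E : X.Modules} {W V : X.Opens} {I : Type u} [Fintype I] [DecidableEq I]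

/-- **The trace of the endomorphism with matrix `A` in a frame is `tr A`.**
[cite: Hartshorne1977, II Ex. 5.1 (a)] -/
theorem trace_app_matrixEnd (hE : IsFiniteLocallyFree E) (e : SheafOfModules.free I ≅ E.over W)
    (k : V ⟶ W) (A : Matrix I I Γ(X, V)) :
    (trace hE).app V (matrixEnd e k A) = A.trace := by
  rw [trace_app_eq_sum hE (SheafOfModules.restrictTrivialisation (R := X.ringCatSheaf) k e)]
  simp only [basisSection_restrictTrivialisation, appLE_matrixEnd_basisSection]
  rw [Matrix.trace]
  refine Finset.sum_congr rfl fun l _ => ?_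
  rw [Matrix.diag_apply, ← coord_def, coord_restrictTrivialisation, Category.id_comp, coord_sum]
  simp only [coord_smul, coord_map_basisSection, mul_ite, mul_one, mul_zero, Finset.sum_ite_eq',
    Finset.mem_univ, if_true]

end Literature.AlgebraicGeometry.Modules

namespace Literature.AlgebraicGeometry.Deformation

open Literature.AlgebraicGeometry.Modules Literature.AlgebraicGeometry.Motives

/-! ### `matrixOfIdeal` of a block matrix -/

section MatrixOfIdeal

variable {Y Z₀ Z₁ : Scheme.{u}} {j : Y ⟶ Z₀} {i : Z₀ ⟶ Z₁}
  (eI : (Scheme.Modules.pushforward i).obj ((Scheme.Modules.pushforward j).obj (unitModule Y)) ≅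
    idealModule i)

/-- Entries of `matrixOfIdeal`. [folklore] -/
lemma matrixOfIdeal_apply {m n : Type*} (W : Z₁.Opens) (A : Matrix m n Γ(Z₁, W))
    (hA : A.map (i.app W).hom = 0) (a : m) (b : n) :
    matrixOfIdeal eI W A hA a b = ofIdeal eI W (A a b) (apply_eq_zero_of_map_eq_zero hA a b) := rfl

/-- **`matrixOfIdeal` of a block matrix is the block matrix of the `matrixOfIdeal`s.** [folklore] -/
theorem matrixOfIdeal_fromBlocks {l m n o : Type*} (W : Z₁.Opens) (A : Matrix n l Γ(Z₁, W))
    (B : Matrix n m Γ(Z₁, W)) (C : Matrix o l Γ(Z₁, W)) (D : Matrix o m Γ(Z₁, W))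
    (h : (Matrix.fromBlocks A B C D).map (i.app W).hom = 0)
    (hA : A.map (i.app W).hom = 0) (hB : B.map (i.app W).hom = 0) (hC : C.map (i.app W).hom = 0)
    (hD : D.map (i.app W).hom = 0) :
    matrixOfIdeal eI W (Matrix.fromBlocks A B C D) h =
      Matrix.fromBlocks (matrixOfIdeal eI W A hA) (matrixOfIdeal eI W B hB) (matrixOfIdeal eI W C hC)
        (matrixOfIdeal eI W D hD) := by
  ext a b
  rcases a with a | a <;> rcases b with b | b <;>
    simp only [matrixOfIdeal_apply, Matrix.fromBlocks_apply₁₁, Matrix.fromBlocks_apply₁₂,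
      Matrix.fromBlocks_apply₂₁, Matrix.fromBlocks_apply₂₂]

/-- Blocks of a matrix killed by `i♯` are killed by `i♯`. [folklore] -/
lemma map_toBlocks_eq_zero {l m n o : Type*} (W : Z₁.Opens) (M : Matrix (n ⊕ o) (l ⊕ m) Γ(Z₁, W))
    (h : M.map (i.app W).hom = 0) :
    M.toBlocks₁₁.map (i.app W).hom = 0 ∧ M.toBlocks₁₂.map (i.app W).hom = 0 ∧
      M.toBlocks₂₁.map (i.app W).hom = 0 ∧ M.toBlocks₂₂.map (i.app W).hom = 0 := by
  refine ⟨?_, ?_, ?_, ?_⟩ <;> ext a b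
  · exact congrFun (congrFun h (Sum.inl a)) (Sum.inl b)
  · exact congrFun (congrFun h (Sum.inl a)) (Sum.inr b)
  · exact congrFun (congrFun h (Sum.inr a)) (Sum.inl b)
  · exact congrFun (congrFun h (Sum.inr a)) (Sum.inr b)

/-- `matrixOfIdeal 0 = 0`. [folklore] -/
lemma matrixOfIdeal_zero {m n : Type*} (W : Z₁.Opens) (h : (0 : Matrix m n Γ(Z₁, W)).map (i.app W).hom = 0) :
    matrixOfIdeal eI W (0 : Matrix m n Γ(Z₁, W)) h = 0 := by
  ext a b
  exact ofIdeal_zero eI W (map_zero _)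

end MatrixOfIdeal

/-! ### The adapted data read on the base: block upper triangular -/

section Adapted

variable {Y Z₀ Z₁ : Scheme.{u}} {j : Y ⟶ Z₀} {i : Z₀ ⟶ Z₁}
  (eI : (Scheme.Modules.pushforward i).obj ((Scheme.Modules.pushforward j).obj (unitModule Y)) ≅
    idealModule i)
  {S : ShortComplex Z₀.Modules} {hS : S.ShortExact} {ι : Type u} {A : AdaptedFrameCover i S ι}
  (L₁ : A.cover₁.Lifts) (L₃ : A.cover₃.Lifts)
  (X : ∀ a b, Matrix (A.I₁ a) (A.I₃ b) Γ(Z₁, A.U a ⊓ A.U b))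
  (hX : ∀ a b, (X a b).map (i.app (A.U a ⊓ A.U b)).hom =
    A.offDiag (hS := hS) a b (A.U a ⊓ A.U b) inf_le_left inf_le_right)

/-- **The defect of the adapted lifts read on `Y` is block upper triangular** with diagonal blocks
the defects of `T̃¹` and `T̃³` read on `Y`. [cite: Hartshorne2010, §7 (proof of Thm. 7.1)] -/
theorem kdefAt_adapted (a b d : ι) (W : Z₁.Opens) (ha : W ≤ A.U a) (hb : W ≤ A.U b) (hd : W ≤ A.U d) :
    ∃ M, (AdaptedFrameCover.Lifts.adapted (hS := hS) L₁ L₃ X hX).kdefAt eI a b d W ha hb hd =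
      Matrix.fromBlocks (L₁.kdefAt eI a b d W ha hb hd) M 0 (L₃.kdefAt eI a b d W ha hb hd) := by
  have hdef := AdaptedFrameCover.Lifts.defect_adapted (hS := hS) L₁ L₃ X hX a b d W ha hb hd
  have hmap := (AdaptedFrameCover.Lifts.adapted (hS := hS) L₁ L₃ X hX).map_defect a b d W ha hb hd
  rw [hdef, Matrix.fromBlocks_map, ← Matrix.fromBlocks_zero, Matrix.fromBlocks_inj] at hmap
  obtain ⟨h11, h12, -, h22⟩ := hmap
  refine ⟨matrixOfIdeal eI W _ h12, ?_⟩
  rw [FrameCover.Lifts.kdefAt, matrixOfIdeal_congr eI W hdef _ (by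
      rw [Matrix.fromBlocks_map, h11, h12, h22, Matrix.map_zero _ (map_zero _), Matrix.fromBlocks_zero]),
    matrixOfIdeal_fromBlocks eI W _ _ _ _ _ h11 h12 (Matrix.map_zero _ (map_zero _)) h22,
    matrixOfIdeal_zero]
  rfl

include L₁ L₃ hX in
/-- **The transition matrices of the base framing of the adapted cover are block upper triangular**,
with diagonal blocks those of the base framings of `F₁` and `F₃` (stated in the presence of systems of
lifts, through whose reductions all three are computed, `T_baseFraming`). [cite: Hartshorne1977, II Ex. 5.16 (d)] -/
theorem T_baseFraming_cover₂ (a b : ι) (V : Y.Opens) (ha : V ≤ baseOpen j i (A.U a))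
    (hb : V ≤ baseOpen j i (A.U b)) :
    ∃ M, ((A.cover₂ hS).baseFraming j).T a b V ha hb =
      Matrix.fromBlocks ((A.cover₁.baseFraming j).T a b V ha hb) M 0 ((A.cover₃.baseFraming j).T a b V ha hb) := by
  -- compare all three with the reductions of the lifted matrices over `W = U_a ∩ U_b`, then restrict to `V`
  set W : Z₁.Opens := A.U a ⊓ A.U b
  have hV : V ≤ baseOpen j i W := by
    change V ≤ j ⁻¹ᵁ (i ⁻¹ᵁ (A.U a ⊓ A.U b))
    rw [Scheme.Hom.preimage_inf, Scheme.Hom.preimage_inf]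
    exact le_inf ha hb
  have e₂ := (((A.cover₂ hS).baseFraming j).T_map a b
    (((Opens.map j.base).map ((Opens.map i.base).map (homOfLE (inf_le_left : W ≤ A.U a)))).le)
    (((Opens.map j.base).map ((Opens.map i.base).map (homOfLE (inf_le_right : W ≤ A.U b)))).le) hV)
  have e₁ := ((A.cover₁.baseFraming j).T_map a b
    (((Opens.map j.base).map ((Opens.map i.base).map (homOfLE (inf_le_left : W ≤ A.U a)))).le)
    (((Opens.map j.base).map ((Opens.map i.base).map (homOfLE (inf_le_right : W ≤ A.U b)))).le) hV)
  have e₃ := ((A.cover₃.baseFraming j).T_map a b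
    (((Opens.map j.base).map ((Opens.map i.base).map (homOfLE (inf_le_left : W ≤ A.U a)))).le)
    (((Opens.map j.base).map ((Opens.map i.base).map (homOfLE (inf_le_right : W ≤ A.U b)))).le) hV)
  rw [FrameCover.T_baseFraming (A.cover₂ hS) (AdaptedFrameCover.Lifts.adapted (hS := hS) L₁ L₃ X hX)] at e₂
  rw [FrameCover.T_baseFraming A.cover₁ L₁] at e₁
  rw [FrameCover.T_baseFraming A.cover₃ L₃] at e₃
  refine ⟨(((X a b).map (secRes Z₁ (le_inf inf_le_left inf_le_right))).map (red j i W)).map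
    (secRes Y hV), ?_⟩
  rw [← e₂, ← e₁, ← e₃, AdaptedFrameCover.Lifts.TOn_adapted, fromBlocks_zero₂₁_map _ _ _ _ (map_zero _),
    fromBlocks_zero₂₁_map _ _ _ _ (map_zero _)]
  · exact inf_le_left
  · exact inf_le_right

variable (h₁ : IsFiniteLocallyFree ((Scheme.Modules.pullback j).obj S.X₁))
  (h₂ : IsFiniteLocallyFree ((Scheme.Modules.pullback j).obj S.X₂))
  (h₃ : IsFiniteLocallyFree ((Scheme.Modules.pullback j).obj S.X₃))

/-- **The traces of the local operators of the three defect cochains add up** (all three live on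
the cover `(j⁻¹i⁻¹U_a)_a` of `Y`): `tr(op κ(c²)_β) = tr(op κ(c¹)_β) + tr(op κ(c³)_β)` over `V ⊓ U_β`.
[cite: BuchweitzFlenner2003, Prop. 4.2] -/
theorem trace_locOp_defectCochain_adapted (V : Y.Opens) (β : Fin 3 → ι) :
    (trace h₂).app _ (((A.cover₂ hS).baseFraming j).locOp
        ((AdaptedFrameCover.Lifts.adapted (hS := hS) L₁ L₃ X hX).defectCochain eI) V β) =
      (trace h₁).app _ ((A.cover₁.baseFraming j).locOp (L₁.defectCochain eI) V β) +
        (trace h₃).app _ ((A.cover₃.baseFraming j).locOp (L₃.defectCochain eI) V β) := by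
  simp only [Framing.locOp, Framing.op, trace_app_matrixEnd, FrameCover.Lifts.defectCochain_mat]
  obtain ⟨M, hM⟩ := kdefAt_adapted eI (hS := hS) L₁ L₃ X hX (β 0) (β 1) (β (Fin.last 2))
    (A.U (β 0) ⊓ A.U (β 1) ⊓ A.U (β (Fin.last 2))) (inf_le_left.trans inf_le_left)
    (inf_le_left.trans inf_le_right) inf_le_right
  obtain ⟨M', hM'⟩ := T_baseFraming_cover₂ (hS := hS) L₁ L₃ X hX (β (Fin.last 2)) (β 0)
    (V ⊓ face ((A.cover₂ hS).baseFraming j).U β)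
    (((A.cover₂ hS).baseFraming j).inf_face_le V β (Fin.last 2))
    (((A.cover₂ hS).baseFraming j).inf_face_le V β 0)
  rw [hM, hM', fromBlocks_zero₂₁_map _ _ _ _ (map_zero _), trace_fromBlocks_mul_fromBlocks]
  rfl

end Adapted

end Literature.AlgebraicGeometry.Deformation

end
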